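import Mathlib
import Literature.MathematicalPhysics.QuantumManyBody.BoseEinsteinCondensation
import Summits.AtomisticToContinuum.BoseEinsteinCondensation.Theorems.SoloBlindBhattacharyya
import Summits.AtomisticToContinuum.BoseEinsteinCondensation.Theorems.SoloBlindMutualInformation

/-!
# Bounded oscillation of the conditional amplitude for typical environments ⇒ condensation

Solo seat `solo-AtomisticToContinuum-blind`, conjunct `BoseEinsteinCondensation`.

The kernel form of the "oscillation dressing" of the missing lemma (paper §8, `M-oscillation`):
let `Φ ≥ 0` be an `(n+1)`-particle amplitude whose first particle lives in a box `S` of finite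
positive volume.  Suppose there is a measurable set `G` of **good environments** `Y` (configurations
of the other `n` particles) such that for `Y ∈ G` the conditional amplitude `x ↦ Φ (x :: Y)` is
`≤ F Y` everywhere and `≥ θ · F Y` off an exceptional set `E Y` of volume `≤ η · |S|`
(oscillation of `log Φ(· :: Y)` at most `log (1/θ)` on most of the box), while the bad environments
carry conditional mass `∫_{Y ∉ G} ∫ₓ Φ(x :: Y)² ≤ η'`.  Then the uniform mode on `S` is occupied by
at least `(n+1) · (θ (1−η)(1−η'))²` particles (`mul_sq_le_maxOccupation_of_oscillation`), for
every `n`: the hypotheses are dimensionless and, if they hold uniformly in `n` at fixed density,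
give Bose–Einstein condensation through the assembly `hasGroundStateBEC_of_near_positive`.

Proof: for `Y ∈ G` the participation ratio of `Φ(· :: Y)` is `≥ θ (1 − η)`, so the affinity
integrand is `≥ θ(1−η) · ∫ₓ Φ(x :: Y)²`; integrating over `G` gives affinity `≥ θ(1−η)(1−η')`, and
the kernel-checked sandwich `bhattacharyya_sq_le_maxOccupation'` concludes.  The plateau theorem
(`SoloBlindPlateauCondensation`) is the case `θ = 1`, `G = univ`.
-/

open MeasureTheory
open scoped ENNReal

namespace Summit.AtomisticToContinuum.BoseEinsteinCondensation.Theorems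

open Literature.MathematicalPhysics.QuantumManyBody.BoseGas

/-- **Bounded conditional oscillation for typical environments ⇒ macroscopic occupation of the
uniform mode.** See the module docstring; truncated subtraction in `ℝ≥0∞`. -/
theorem mul_sq_le_maxOccupation_of_oscillation {n : ℕ} {S : Set Space} (hS : MeasurableSet S)
    (hS0 : volume S ≠ 0) (hStop : volume S ≠ ⊤)
    {Φ : Config (n + 1) → ℝ} {F : Config n → ℝ} {E : Config n → Set Space} {G : Set (Config n)}
    (hG : MeasurableSet G) (hΦ0 : 0 ≤ Φ) (hΦm : Measurable Φ)
    (hΦ1 : ∫⁻ Y : Config n, ∫⁻ x, ENNReal.ofReal (Φ (Matrix.vecCons x Y)) ^ 2 = 1)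
    (hle : ∀ Y x, Φ (Matrix.vecCons x Y) ≤ F Y)
    (hsupp : ∀ Y x, x ∉ S → Φ (Matrix.vecCons x Y) = 0)
    (hEm : ∀ Y, MeasurableSet (E Y)) {θ : ℝ} (hθ0 : 0 ≤ θ)
    (hlow : ∀ Y ∈ G, ∀ x ∈ S, x ∉ E Y → θ * F Y ≤ Φ (Matrix.vecCons x Y))
    {η η' : ℝ≥0∞} (hE : ∀ Y ∈ G, volume (E Y) ≤ η * volume S)
    (hbad : ∫⁻ Y in Gᶜ, ∫⁻ x, ENNReal.ofReal (Φ (Matrix.vecCons x Y)) ^ 2 ≤ η') :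
    (n + 1 : ℝ≥0∞) * (ENNReal.ofReal θ * (1 - η) * (1 - η')) ^ 2 ≤
      maxOccupation (n + 1) (fun X => (Φ X : ℂ)) := by
  -- the uniform mode on `S`
  set V : ℝ≥0∞ := volume S with hV
  set c : ℝ := Real.sqrt (V.toReal)⁻¹ with hc
  have hc0 : 0 ≤ c := Real.sqrt_nonneg _
  have hVpos : 0 < V.toReal := ENNReal.toReal_pos hS0 hStop
  have hc2 : ENNReal.ofReal c ^ 2 = V⁻¹ := by
    rw [← ENNReal.ofReal_pow hc0, hc, Real.sq_sqrt (inv_nonneg.mpr hVpos.le),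
      ENNReal.ofReal_inv_of_pos hVpos, ENNReal.ofReal_toReal hStop]
  set g : Space → ℝ := S.indicator fun _ => c with hg
  have hg0 : 0 ≤ g := fun x => by
    simp only [hg, Pi.zero_apply]
    by_cases hx : x ∈ S
    · rw [Set.indicator_of_mem hx]; exact hc0
    · rw [Set.indicator_of_notMem hx]
  have hgm : Measurable g := measurable_const.indicator hS
  have hg_of : ∀ x, ENNReal.ofReal (g x) = S.indicator (fun _ => ENNReal.ofReal c) x := by
    intro x
    simp only [hg]
    by_cases hx : x ∈ S
    · rw [Set.indicator_of_mem hx, Set.indicator_of_mem hx]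
    · rw [Set.indicator_of_notMem hx, Set.indicator_of_notMem hx, ENNReal.ofReal_zero]
  have hg1 : ∫⁻ x, ENNReal.ofReal (g x) ^ 2 = 1 := by
    have : (fun x => ENNReal.ofReal (g x) ^ 2) = S.indicator (fun _ => ENNReal.ofReal c ^ 2) := by
      funext x
      rw [hg_of]
      by_cases hx : x ∈ S
      · rw [Set.indicator_of_mem hx, Set.indicator_of_mem hx]
      · rw [Set.indicator_of_notMem hx, Set.indicator_of_notMem hx, zero_pow two_ne_zero]
    rw [this, lintegral_indicator_const hS, hc2, ENNReal.inv_mul_cancel hS0 hStop]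
  have hF0 : ∀ Y, 0 ≤ F Y := fun Y => (hΦ0 _).trans (hle Y 0)
  set κ : ℝ≥0∞ := ENNReal.ofReal θ * (1 - η) with hκ
  -- per good `Y`: affinity integrand ≥ κ · conditional mass
  have hkey : ∀ Y ∈ G,
      κ * ∫⁻ x, ENNReal.ofReal (Φ (Matrix.vecCons x Y)) ^ 2 ≤
        (∫⁻ x, ENNReal.ofReal (g x) * ENNReal.ofReal (Φ (Matrix.vecCons x Y))) *
          (∫⁻ x, ENNReal.ofReal (Φ (Matrix.vecCons x Y)) ^ 2) ^ (1 / 2 : ℝ) := by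
    intro Y hY
    set P : ℝ≥0∞ := ∫⁻ x, ENNReal.ofReal (Φ (Matrix.vecCons x Y)) ^ 2 with hP
    set f : ℝ≥0∞ := ENNReal.ofReal (F Y) with hf
    -- (a) `P ≤ f² V`
    have ha : P ≤ f ^ 2 * V := by
      calc P ≤ ∫⁻ x, S.indicator (fun _ => f ^ 2) x := by
            refine lintegral_mono fun x => ?_
            by_cases hx : x ∈ S
            · rw [Set.indicator_of_mem hx]
              exact pow_le_pow_left' (ENNReal.ofReal_le_ofReal (hle Y x)) 2
            · rw [Set.indicator_of_notMem hx, hsupp Y x hx]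
              simp
        _ = f ^ 2 * V := lintegral_indicator_const hS _
    -- (b) `∫ g Φ ≥ c θ f (1-η) V`
    have hb : ENNReal.ofReal c * (ENNReal.ofReal θ * f) * ((1 - η) * V) ≤
        ∫⁻ x, ENNReal.ofReal (g x) * ENNReal.ofReal (Φ (Matrix.vecCons x Y)) := by
      have hdiff : (1 - η) * V ≤ volume (S \ E Y) := by
        refine le_trans ?_ le_measure_sdiff
        rw [ENNReal.sub_mul (fun _ _ => hStop), one_mul]
        exact tsub_le_tsub_left (hE Y hY) _
      calc ENNReal.ofReal c * (ENNReal.ofReal θ * f) * ((1 - η) * V)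
          ≤ ENNReal.ofReal c * (ENNReal.ofReal θ * f) * volume (S \ E Y) :=
            mul_le_mul' le_rfl hdiff
        _ = ∫⁻ x, (S \ E Y).indicator (fun _ => ENNReal.ofReal c * (ENNReal.ofReal θ * f)) x :=
            (lintegral_indicator_const (hS.diff (hEm Y)) _).symm
        _ ≤ _ := by
            refine lintegral_mono fun x => ?_
            by_cases hx : x ∈ S \ E Y
            · rw [Set.indicator_of_mem hx, hg_of, Set.indicator_of_mem hx.1, hf,
                ← ENNReal.ofReal_mul hθ0]
              exact mul_le_mul' le_rfl (ENNReal.ofReal_le_ofReal (hlow Y hY x hx.1 hx.2))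
            · rw [Set.indicator_of_notMem hx]
              exact bot_le
    -- (c) `P^{1/2} ≤ c f V`
    have hcV : (ENNReal.ofReal c * f * V) ^ 2 = f ^ 2 * V := by
      rw [mul_pow, mul_pow, hc2, sq V, mul_assoc, mul_comm (f ^ 2), ← mul_assoc, ← mul_assoc,
        ENNReal.inv_mul_cancel hS0 hStop, one_mul, mul_comm]
    have hroot : P ^ (1 / 2 : ℝ) ≤ ENNReal.ofReal c * f * V := by
      have h1 : P ^ (1 / 2 : ℝ) ≤ ((ENNReal.ofReal c * f * V) ^ 2) ^ (1 / 2 : ℝ) :=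
        ENNReal.rpow_le_rpow (ha.trans_eq hcV.symm) (by norm_num)
      rwa [← ENNReal.rpow_two, ← ENNReal.rpow_mul, show (2 : ℝ) * (1 / 2) = 1 by norm_num,
        ENNReal.rpow_one] at h1
    have hPP : P = P ^ (1 / 2 : ℝ) * P ^ (1 / 2 : ℝ) := by
      rw [← ENNReal.rpow_add_of_nonneg _ _ (by norm_num) (by norm_num)]
      norm_num
    calc κ * P = (κ * P ^ (1 / 2 : ℝ)) * P ^ (1 / 2 : ℝ) := by
          conv_rhs => rw [mul_assoc, ← hPP]
      _ ≤ (ENNReal.ofReal c * (ENNReal.ofReal θ * f) * ((1 - η) * V)) * P ^ (1 / 2 : ℝ) := by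
          refine mul_le_mul' ?_ le_rfl
          calc κ * P ^ (1 / 2 : ℝ) ≤ κ * (ENNReal.ofReal c * f * V) := mul_le_mul' le_rfl hroot
            _ = ENNReal.ofReal c * (ENNReal.ofReal θ * f) * ((1 - η) * V) := by
                rw [hκ]; ring
      _ ≤ _ := mul_le_mul' hb le_rfl
  -- integrate over the good environments
  have hmeasP : Measurable fun Y : Config n => ∫⁻ x, ENNReal.ofReal (Φ (Matrix.vecCons x Y)) ^ 2 :=
    (((hΦm.comp measurable_vecCons).ennreal_ofReal).pow_const 2).lintegral_prod_left'
  have hGmass : 1 - η' ≤ ∫⁻ Y in G, ∫⁻ x, ENNReal.ofReal (Φ (Matrix.vecCons x Y)) ^ 2 := by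
    have hsplit := lintegral_add_compl
      (fun Y : Config n => ∫⁻ x, ENNReal.ofReal (Φ (Matrix.vecCons x Y)) ^ 2) hG (μ := volume)
    rw [hΦ1] at hsplit
    have hbtop : ∫⁻ Y in Gᶜ, ∫⁻ x, ENNReal.ofReal (Φ (Matrix.vecCons x Y)) ^ 2 ≠ ⊤ :=
      ne_top_of_le_ne_top ENNReal.one_ne_top (hsplit ▸ le_add_self)
    rw [ENNReal.eq_sub_of_add_eq hbtop hsplit]
    exact tsub_le_tsub_left hbad _
  have hBC : κ * (1 - η') ≤ ∫⁻ Y : Config n,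
      (∫⁻ x, ENNReal.ofReal (g x) * ENNReal.ofReal (Φ (Matrix.vecCons x Y))) *
        (∫⁻ x, ENNReal.ofReal (Φ (Matrix.vecCons x Y)) ^ 2) ^ (1 / 2 : ℝ) := by
    calc κ * (1 - η') ≤ κ * ∫⁻ Y in G, ∫⁻ x, ENNReal.ofReal (Φ (Matrix.vecCons x Y)) ^ 2 :=
          mul_le_mul' le_rfl hGmass
      _ = ∫⁻ Y in G, κ * ∫⁻ x, ENNReal.ofReal (Φ (Matrix.vecCons x Y)) ^ 2 :=
          (lintegral_const_mul _ hmeasP).symm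
      _ = ∫⁻ Y, G.indicator (fun Y => κ * ∫⁻ x, ENNReal.ofReal (Φ (Matrix.vecCons x Y)) ^ 2) Y :=
          (lintegral_indicator hG _).symm
      _ ≤ _ := by
          refine lintegral_mono fun Y => ?_
          by_cases hY : Y ∈ G
          · rw [Set.indicator_of_mem hY]
            exact hkey Y hY
          · rw [Set.indicator_of_notMem hY]
            exact bot_le
  -- sandwich
  have hsand := bhattacharyya_sq_le_maxOccupation' hg0 hΦ0 hgm hΦm hg1 hΦ1
  have hκ' : ENNReal.ofReal θ * (1 - η) * (1 - η') = κ * (1 - η') := by rw [hκ]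
  rw [hκ']
  exact le_trans (mul_le_mul' le_rfl (pow_le_pow_left' hBC 2)) hsand

end Summit.AtomisticToContinuum.BoseEinsteinCondensation.Theorems
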